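import Summits.Ventures.HodgeRepro0.P6AokiQuotientLevel180Data4

/-!
# Aoki's quotient `B_q/(S_q + D_q)` at the level q = 180 — kernel certificate (part 9 of 18 — the rows 116 … 154 of `hℓ`)

The kernel-decided fact `hℓ` of `level_of_decided` (the echelon rows are unit at their pivots) on the rows `116 … 154` (rows `116 + i`, `i < 39`).
-/

namespace HodgeRepro0.P6AokiQuotient

namespace L180
/-- level 180: the rows `116 + i`, `i < 39`, of the kernel-decided fact `hℓ`. -/
theorem fact_hell_3 : ∀ i < 39, ∀ j < 155, (ellL.getD (116 + i) []).getD (pivL.getD j 0) 0 = if 116 + i = j then 1 else 0 := by decide +kernel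
end L180

end HodgeRepro0.P6AokiQuotient
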